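import Mathlib.RingTheory.Polynomial.UniqueFactorization
import Mathlib.LinearAlgebra.Dimension.Finite
import Mathlib.LinearAlgebra.Dimension.Free
import Mathlib.LinearAlgebra.FiniteDimensional.Lemmas
import Mathlib.Data.Nat.Choose.Cast
import Mathlib.RingTheory.Ideal.Quotient.Operations
import Literature.NumberTheory.DiophantineGeometry.PlaneCurveSections
import HarnessLib

/-!
# Steer / CLAIM R kernel, file R1: THE AFFINE PLANE BÉZOUT INEQUALITY — `dim_K K[y,z]⧸(f, g) ≤ deg f · deg g`

OURS (campaign res-hironaka, rung L ★L-G4, slot W4.1, crux `Steer` stmt-ResolutionOfSingularities-16345; res-L0-w41-plan-1 RULING 160d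
«CLAIM R kernel → first free kernel hands»; res-L0-w41-idea-3 g9; consumer: CLAIM R = (K-H) `LemmaI.GeomSupplyRegularCurve` (the
minimal-degree curve of the exceptional `ℙ²` through a non-rational centre is REGULAR at the centre); replaces the role of no printed item;
NOT a statement of the manuscript under review [claim: Hironaka2017, status: under-review]; AI review is weaker than expert review).
Theses-free, definition-free, generic commutative algebra over a field.

For a field `K`, `A = K[X₀, X₁]` (`MvPolynomial (Fin 2) K`), and `f, g ∈ A` RELATIVELY PRIME (`IsRelPrime f g`) and non-zero of total
degrees `a`, `b`: the quotient `A ⧸ (f, g)` is a finite-dimensional `K`-vector space of dimension `≤ a · b`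
(`finite_quotient_span_pair`, `finrank_quotient_span_pair_le`). This is the dimension form of the weak Bézout theorem; it measures
NON-rational common points with their residue degrees (`dim_K A⧸(f,g) = Σ_P [κ(P):K] · i_P(f,g)`, not used here), which is what CLAIM R needs
over an arbitrary (finite, imperfect, …) ground field. Mechanism (pure linear algebra, degree filtration `V_d = A_{≤ d}`):
* `map_mulLeft_restrictTotalDegree_le` — `f · V_{d−a} ⊆ V_d ∩ (f, g)`;
* `inf_map_mulLeft_le` — `f · V_m ∩ g · V_n ⊆ (f g) · V_{n−a}` (coprimality: `f u = g v ⇒ f ∣ v`);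
* `choose_add_le_finrank_inf` — hence `dim (V_d ∩ (f,g)) ≥ C(d−a+2,2) + C(d−b+2,2) − C(d−a−b+2,2)` for `d ≥ a + b`;
* `choose_two_second_difference` — `C(d+2,2) + C(d−a−b+2,2) = C(d−a+2,2) + C(d−b+2,2) + a b` for `d ≥ a + b`;
* `card_le_mul_of_linearIndependent` — a `K`-free family in `A ⧸ (f,g)` has `≤ a b` members (lift to some `V_d`, rank–nullity inside `V_d`);
* `finite_quotient_span_pair`, `finrank_quotient_span_pair_le` — the statement.
[cite: Kunz2005PlaneAlgebraicCurves, App. A Lemma A.11] [folklore]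
-/

noncomputable section

-- single-problem summit: the doubled namespace component `ResolutionOfSingularities` is forced
set_option linter.dupNamespace false

namespace Summit.ResolutionOfSingularities.ResolutionOfSingularities.Theorems.SwitchingDichotomy.ClaimR

open MvPolynomial Module
open Literature.NumberTheory.DiophantineGeometry.PlaneCurve
  (finrank_restrictTotalDegree_fin_two finite_restrictTotalDegree)

variable {K : Type*} [Field K]

/-- Notation-free abbreviations are avoided (typer lint); we write `restrictTotalDegree (Fin 2) K d` throughout. -/
private theorem totalDegree_le_of_mul_mem {f u : MvPolynomial (Fin 2) K} (hf : f ≠ 0) {n : ℕ}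
    (h : f * u ∈ restrictTotalDegree (Fin 2) K n) : u.totalDegree + f.totalDegree ≤ n ∨ u = 0 := by
  by_cases hu : u = 0
  · exact Or.inr hu
  · left
    rw [mem_restrictTotalDegree, totalDegree_mul_of_isDomain hf hu] at h
    omega

/-- `f · V_m ⊆ V_d` when `m + deg f ≤ d`. [folklore] -/
theorem map_mulLeft_restrictTotalDegree_le_restrictTotalDegree (f : MvPolynomial (Fin 2) K) {m d : ℕ}
    (hmd : m + f.totalDegree ≤ d) :
    (restrictTotalDegree (Fin 2) K m).map (LinearMap.mulLeft K f) ≤ restrictTotalDegree (Fin 2) K d := by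
  rintro x ⟨u, hu, rfl⟩
  rw [SetLike.mem_coe, mem_restrictTotalDegree] at hu
  rw [LinearMap.mulLeft_apply, mem_restrictTotalDegree]
  calc (f * u).totalDegree ≤ f.totalDegree + u.totalDegree := totalDegree_mul f u
    _ ≤ d := by omega

/-- `f · V_m ⊆ V_d ∩ (f, g)` when `m + deg f ≤ d`. [folklore] -/
theorem map_mulLeft_restrictTotalDegree_le (f g : MvPolynomial (Fin 2) K) {m d : ℕ} (hmd : m + f.totalDegree ≤ d) :
    (restrictTotalDegree (Fin 2) K m).map (LinearMap.mulLeft K f) ≤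
      restrictTotalDegree (Fin 2) K d ⊓ (Ideal.span {f, g}).restrictScalars K := by
  refine le_inf (map_mulLeft_restrictTotalDegree_le_restrictTotalDegree f hmd) ?_
  rintro x ⟨u, -, rfl⟩
  change f * u ∈ Ideal.span {f, g}
  exact Ideal.mul_mem_right _ _ (Ideal.subset_span (by simp))

/-- `g · V_m ⊆ V_d ∩ (f, g)` when `m + deg g ≤ d`. [folklore] -/
theorem map_mulLeft_restrictTotalDegree_le' (f g : MvPolynomial (Fin 2) K) {m d : ℕ} (hmd : m + g.totalDegree ≤ d) :
    (restrictTotalDegree (Fin 2) K m).map (LinearMap.mulLeft K g) ≤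
      restrictTotalDegree (Fin 2) K d ⊓ (Ideal.span {f, g}).restrictScalars K := by
  refine le_inf (map_mulLeft_restrictTotalDegree_le_restrictTotalDegree g hmd) ?_
  rintro x ⟨u, -, rfl⟩
  change g * u ∈ Ideal.span {f, g}
  exact Ideal.mul_mem_right _ _ (Ideal.subset_span (by simp))

/-- `dim_K (f · V_m) = dim_K V_m = C(m+2, 2)` for `f ≠ 0` (multiplication by `f` is injective on the domain `A`). [folklore] -/
theorem finrank_map_mulLeft_restrictTotalDegree {f : MvPolynomial (Fin 2) K} (hf : f ≠ 0) (m : ℕ) :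
    finrank K ↥((restrictTotalDegree (Fin 2) K m).map (LinearMap.mulLeft K f)) = (m + 2).choose 2 := by
  have hinj : Function.Injective (LinearMap.mulLeft K f) := fun x y hxy => mul_left_cancel₀ hf hxy
  rw [← finrank_restrictTotalDegree_fin_two K m]
  exact (LinearEquiv.finrank_eq (Submodule.equivMapOfInjective _ hinj _)).symm

/-- **Coprimality step.** `f · V_m ∩ g · V_n ⊆ (f g) · V_{n − deg f}`: if `h = f u = g v` then `f ∣ v` (`f`, `g` relatively prime in the UFD
`K[X₀,X₁]`), `v = f w`, `h = (f g) w` and `deg w ≤ n − deg f`. [folklore] -/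
theorem inf_map_mulLeft_le {f g : MvPolynomial (Fin 2) K} (hf : f ≠ 0) (hfg : IsRelPrime f g) (m n : ℕ) :
    (restrictTotalDegree (Fin 2) K m).map (LinearMap.mulLeft K f) ⊓ (restrictTotalDegree (Fin 2) K n).map (LinearMap.mulLeft K g) ≤
      (restrictTotalDegree (Fin 2) K (n - f.totalDegree)).map (LinearMap.mulLeft K (f * g)) := by
  intro h hh
  obtain ⟨⟨u, hu, hfu⟩, ⟨v, hv, hgv⟩⟩ := Submodule.mem_inf.1 hh
  rw [LinearMap.mulLeft_apply] at hfu hgv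
  -- `f ∣ g * v`, hence `f ∣ v`
  have hdvd : f ∣ g * v := ⟨u, by rw [hgv, ← hfu]⟩
  obtain ⟨w, rfl⟩ : f ∣ v := hfg.dvd_of_dvd_mul_left hdvd
  refine ⟨w, ?_, ?_⟩
  · rw [SetLike.mem_coe, mem_restrictTotalDegree]
    rcases totalDegree_le_of_mul_mem hf (n := n) (by simpa using hv) with hle | hw0
    · omega
    · rw [hw0, totalDegree_zero]; exact Nat.zero_le _
  · rw [LinearMap.mulLeft_apply, ← hgv]; ring

/-- **The dimension count.** For `d ≥ deg f + deg g`: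
`dim_K (V_d ∩ (f,g)) + C(d − a − b + 2, 2) ≥ C(d − a + 2, 2) + C(d − b + 2, 2)` (`a = deg f`, `b = deg g`), from
`f V_{d−a} + g V_{d−b} ⊆ V_d ∩ (f,g)` and `dim (S ⊔ T) + dim (S ⊓ T) = dim S + dim T`. [folklore] -/
theorem choose_add_le_finrank_inf {f g : MvPolynomial (Fin 2) K} (hf : f ≠ 0) (hg : g ≠ 0) (hfg : IsRelPrime f g) {d : ℕ}
    (hd : f.totalDegree + g.totalDegree ≤ d) :
    (d - f.totalDegree + 2).choose 2 + (d - g.totalDegree + 2).choose 2 ≤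
      finrank K ↥(restrictTotalDegree (Fin 2) K d ⊓ (Ideal.span {f, g}).restrictScalars K) +
        (d - f.totalDegree - g.totalDegree + 2).choose 2 := by
  set a := f.totalDegree with ha
  set b := g.totalDegree with hb
  haveI : Module.Finite K ↥(restrictTotalDegree (Fin 2) K d) := finite_restrictTotalDegree K (Fin 2) d
  set S := (restrictTotalDegree (Fin 2) K (d - a)).map (LinearMap.mulLeft K f) with hS
  set T := (restrictTotalDegree (Fin 2) K (d - b)).map (LinearMap.mulLeft K g) with hT
  set W := restrictTotalDegree (Fin 2) K d ⊓ (Ideal.span {f, g}).restrictScalars K with hW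
  have hSW : S ≤ W := map_mulLeft_restrictTotalDegree_le f g (by omega)
  have hTW : T ≤ W := map_mulLeft_restrictTotalDegree_le' f g (by omega)
  have hWV : W ≤ restrictTotalDegree (Fin 2) K d := inf_le_left
  haveI : Module.Finite K ↥W := Submodule.finiteDimensional_of_le hWV
  haveI : Module.Finite K ↥S := Submodule.finiteDimensional_of_le hSW
  haveI : Module.Finite K ↥T := Submodule.finiteDimensional_of_le hTW
  haveI : Module.Finite K ↥(S ⊔ T) := Submodule.finiteDimensional_of_le (sup_le hSW hTW)
  have hsup : finrank K ↥(S ⊔ T) ≤ finrank K ↥W := Submodule.finrank_mono (sup_le hSW hTW)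
  have hST := Submodule.finrank_sup_add_finrank_inf_eq S T
  have hSf : finrank K ↥S = (d - a + 2).choose 2 := finrank_map_mulLeft_restrictTotalDegree hf (d - a)
  have hTf : finrank K ↥T = (d - b + 2).choose 2 := finrank_map_mulLeft_restrictTotalDegree hg (d - b)
  -- the intersection is small
  set U := (restrictTotalDegree (Fin 2) K (d - b - a)).map (LinearMap.mulLeft K (f * g)) with hU
  have hinfU : S ⊓ T ≤ U := inf_map_mulLeft_le hf hfg (d - a) (d - b)
  have hUV : U ≤ restrictTotalDegree (Fin 2) K d := by
    refine map_mulLeft_restrictTotalDegree_le_restrictTotalDegree (f * g) ?_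
    rw [totalDegree_mul_of_isDomain hf hg]; omega
  haveI : Module.Finite K ↥U := Submodule.finiteDimensional_of_le hUV
  have hinf : finrank K ↥(S ⊓ T) ≤ (d - a - b + 2).choose 2 := by
    calc finrank K ↥(S ⊓ T) ≤ finrank K ↥U := Submodule.finrank_mono hinfU
      _ = (d - b - a + 2).choose 2 := finrank_map_mulLeft_restrictTotalDegree (mul_ne_zero hf hg) _
      _ = (d - a - b + 2).choose 2 := by rw [show d - b - a = d - a - b by omega]
  omega

/-- **The binomial identity** behind Bézout: for `d ≥ a + b`, `C(d+2,2) + C(d−a−b+2,2) = C(d−a+2,2) + C(d−b+2,2) + a·b` (the second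
difference of `x ↦ C(x+2,2)` with steps `a`, `b` is `a b`). [folklore] -/
theorem choose_two_second_difference {a b d : ℕ} (hd : a + b ≤ d) :
    (d + 2).choose 2 + (d - a - b + 2).choose 2 = (d - a + 2).choose 2 + (d - b + 2).choose 2 + a * b := by
  obtain ⟨e, rfl⟩ : ∃ e, d = a + b + e := ⟨d - a - b, by omega⟩
  have h1 : a + b + e - a - b = e := by omega
  have h2 : a + b + e - a = b + e := by omega
  have h3 : a + b + e - b = a + e := by omega
  rw [h1, h2, h3]
  have key : ((a + b + e + 2).choose 2 : ℚ) + ((e + 2).choose 2 : ℚ) =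
      ((b + e + 2).choose 2 : ℚ) + ((a + e + 2).choose 2 : ℚ) + (a * b : ℚ) := by
    rw [Nat.cast_choose_two, Nat.cast_choose_two, Nat.cast_choose_two, Nat.cast_choose_two]
    push_cast
    ring
  exact_mod_cast key

/-- **Rank bound.** Every `K`-linearly independent finite family in `A ⧸ (f, g)` has at most `deg f · deg g` members: lift the family into some
`V_d` (`d ≥ a + b` and `≥` every lift's degree); its span `P` meets `(f,g)` trivially, so `|family| + dim (V_d ∩ (f,g)) ≤ dim V_d = C(d+2,2)`;
combine with `choose_add_le_finrank_inf` and `choose_two_second_difference`. [folklore] -/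
theorem card_le_mul_of_linearIndependent {f g : MvPolynomial (Fin 2) K} (hf : f ≠ 0) (hg : g ≠ 0) (hfg : IsRelPrime f g)
    (s : Finset (MvPolynomial (Fin 2) K ⧸ Ideal.span {f, g}))
    (hs : LinearIndependent K (fun i : s => (i : MvPolynomial (Fin 2) K ⧸ Ideal.span {f, g}))) :
    s.card ≤ f.totalDegree * g.totalDegree := by
  classical
  -- lift the family
  let π : MvPolynomial (Fin 2) K →ₗ[K] MvPolynomial (Fin 2) K ⧸ Ideal.span {f, g} :=
    (Ideal.Quotient.mkₐ K (Ideal.span {f, g})).toLinearMap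
  have hπ : ∀ x, π x = Ideal.Quotient.mk (Ideal.span {f, g}) x := fun x => rfl
  have hsurj : ∀ i : s, ∃ p : MvPolynomial (Fin 2) K, π p = (i : MvPolynomial (Fin 2) K ⧸ Ideal.span {f, g}) :=
    fun i => Ideal.Quotient.mk_surjective (i : MvPolynomial (Fin 2) K ⧸ Ideal.span {f, g})
  choose p hp using hsurj
  -- a common degree bound, and the two counting facts at that degree
  set d := f.totalDegree + g.totalDegree + s.attach.sup (fun i => (p i).totalDegree) with hd
  have hpd : ∀ i : s, p i ∈ restrictTotalDegree (Fin 2) K d := by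
    intro i
    rw [mem_restrictTotalDegree]
    have : (p i).totalDegree ≤ s.attach.sup (fun i => (p i).totalDegree) :=
      Finset.le_sup (f := fun i => (p i).totalDegree) (Finset.mem_attach s i)
    omega
  have hcount := choose_add_le_finrank_inf hf hg hfg (d := d) (by omega)
  have hident := choose_two_second_difference (a := f.totalDegree) (b := g.totalDegree) (d := d) (by omega)
  -- the lifted family is linearly independent and its span meets `I` trivially
  have hs' : LinearIndependent K (⇑π ∘ p) := by
    have hcomp : (⇑π ∘ p) = (fun i : s => (i : MvPolynomial (Fin 2) K ⧸ Ideal.span {f, g})) :=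
      funext fun i => hp i
    rw [hcomp]; exact hs
  have hplin : LinearIndependent K p := LinearIndependent.of_comp π hs'
  set P : Submodule K (MvPolynomial (Fin 2) K) := Submodule.span K (Set.range p) with hP
  have hPV : P ≤ restrictTotalDegree (Fin 2) K d := by
    rw [hP, Submodule.span_le]
    rintro x ⟨i, rfl⟩
    exact hpd i
  set W := restrictTotalDegree (Fin 2) K d ⊓ (Ideal.span {f, g}).restrictScalars K with hW
  have hPW : P ⊓ W = ⊥ := by
    rw [eq_bot_iff]
    intro x hx
    obtain ⟨hxP, hxW⟩ := Submodule.mem_inf.1 hx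
    have hxI : x ∈ Ideal.span {f, g} := (Submodule.mem_inf.1 hxW).2
    rw [hP] at hxP
    obtain ⟨c, rfl⟩ := (Finsupp.mem_span_range_iff_exists_finsupp).1 hxP
    -- apply `π`: the image is `0`
    have h0 : π (c.sum fun i a => a • p i) = 0 := by
      rw [hπ]; exact Ideal.Quotient.eq_zero_iff_mem.2 hxI
    rw [map_finsuppSum] at h0
    simp only [map_smul] at h0
    have hc : c = 0 := by
      apply linearIndependent_iff.1 hs' c
      rw [Finsupp.linearCombination_apply]
      exact h0
    rw [Submodule.mem_bot, hc, Finsupp.sum_zero_index]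
  haveI : Module.Finite K ↥(restrictTotalDegree (Fin 2) K d) := finite_restrictTotalDegree K (Fin 2) d
  haveI : Module.Finite K ↥P := Submodule.finiteDimensional_of_le hPV
  haveI : Module.Finite K ↥W := Submodule.finiteDimensional_of_le (inf_le_left : W ≤ _)
  haveI : Module.Finite K ↥(P ⊔ W) := Submodule.finiteDimensional_of_le (sup_le hPV inf_le_left)
  have hPf : finrank K ↥P = s.card := by
    rw [hP, finrank_span_eq_card hplin, Fintype.card_coe]
  have hsum := Submodule.finrank_sup_add_finrank_inf_eq P W
  rw [hPW, finrank_bot, add_zero] at hsum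
  have hle : finrank K ↥(P ⊔ W) ≤ (d + 2).choose 2 := by
    rw [← finrank_restrictTotalDegree_fin_two K d]
    exact Submodule.finrank_mono (sup_le hPV inf_le_left)
  omega

/-- **`A ⧸ (f, g)` is finite-dimensional** for relatively prime non-zero `f, g ∈ K[X₀,X₁]`. [cite: Kunz2005PlaneAlgebraicCurves, App. A Lemma A.11] [folklore] -/
theorem finite_quotient_span_pair {f g : MvPolynomial (Fin 2) K} (hf : f ≠ 0) (hg : g ≠ 0) (hfg : IsRelPrime f g) :
    Module.Finite K (MvPolynomial (Fin 2) K ⧸ Ideal.span {f, g}) := by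
  have hr : Module.rank K (MvPolynomial (Fin 2) K ⧸ Ideal.span {f, g}) ≤ (f.totalDegree * g.totalDegree : ℕ) :=
    rank_le fun s hs => card_le_mul_of_linearIndependent hf hg hfg s hs
  exact Module.rank_lt_aleph0_iff.1 (hr.trans_lt Cardinal.natCast_lt_aleph0)

/-- **The affine plane Bézout inequality (dimension form):** `dim_K K[X₀,X₁] ⧸ (f, g) ≤ deg f · deg g` for relatively prime non-zero
`f, g`. [cite: Kunz2005PlaneAlgebraicCurves, App. A Lemma A.11] [folklore] -/
theorem finrank_quotient_span_pair_le {f g : MvPolynomial (Fin 2) K} (hf : f ≠ 0) (hg : g ≠ 0) (hfg : IsRelPrime f g) :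
    finrank K (MvPolynomial (Fin 2) K ⧸ Ideal.span {f, g}) ≤ f.totalDegree * g.totalDegree :=
  finrank_le_of_rank_le (rank_le fun s hs => card_le_mul_of_linearIndependent hf hg hfg s hs)

end Summit.ResolutionOfSingularities.ResolutionOfSingularities.Theorems.SwitchingDichotomy.ClaimR
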